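import Summits.QuantumFields.YangMills.Theorems.UniversalDetectorCurvatureEdgeGlue
import HarnessLib

/-!
# Crux `BalabanLadder.NT` (stmt-QuantumFields-19353), LINE g10-3 «transverse curvature» (registry skeleton
# `Cruxes/NT/Lines/transverse_curvature_birth.lean` 44ac04e8239a, planner `ym-idea-8` g10): the registered stub
# `stub_curvatureEdgeGlue : CurvatureEdgeGlue` BY NAME AND SIGNATURE

The third stub of the NT registry skeleton is the route item `UniversalDetector.CurvatureEdgeGlue` (stmt-QuantumFields-24088,
`SchemeCurvatureLaws → HankelCeiling → SchemeEdgeLaws`: far-boundedness and the transverse CURVATURE law imply the TRANS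
clause by reflection-positivity Cauchy–Schwarz with the difference observable `P_q(y) − P_q(y+e_k)`).  Its proof landed as
`Cruxes.UniversalDetectorHankel.universalDetector_curvatureEdgeGlue` (p697426, planner `ym-idea-8` g10); this file only
re-exposes it under the registered stub name, so the skeleton's third `sorry` closes by
`exact Summit.QuantumFields.YangMills.Theorems.BalabanLadderNTTransverseCurvatureStubs.stub_curvatureEdgeGlue`
(or by the planner's theorem directly).  Fleet lead `ym-spine-19353-p1` g25.

HONEST FRAMING: glue only; the deciding stub `stub_schemeCurvatureLaws` (24087, engine) and the residual
`stub_skewAtScheme` (26596 = NT clause (ii) at the scheme) remain OPEN; NT, rung R2a and the summit are untouched; the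
Yang–Mills mass gap is NOT proved. [folklore]
-/

set_option autoImplicit false

namespace Summit.QuantumFields.YangMills.Theorems.BalabanLadderNTTransverseCurvatureStubs

open Summit.QuantumFields.YangMills.Theses.UniversalDetector

/-- **Registered stub `stub_curvatureEdgeGlue` of LINE g10-3, BY NAME AND SIGNATURE**: `CurvatureEdgeGlue` holds — it is the
planner's landed theorem `Cruxes.UniversalDetectorHankel.universalDetector_curvatureEdgeGlue` (BDD ∧ CURV ⇒ TRANS by RPCS with a
difference observable, then repacking EDGE ∧ TRANS ∧ NONCONTACT at the same scheme). [folklore] -/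
theorem stub_curvatureEdgeGlue : CurvatureEdgeGlue :=
  Summit.QuantumFields.YangMills.Cruxes.UniversalDetectorHankel.universalDetector_curvatureEdgeGlue

end Summit.QuantumFields.YangMills.Theorems.BalabanLadderNTTransverseCurvatureStubs
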